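import Summits.QuantumFields.YangMills.Theorems.BalabanUVNodesN18TorusDomainCover
import Summits.QuantumFields.YangMills.Theorems.BalabanUVNodesN18CombStepOrbitFrame
import HarnessLib

/-!
# BalabanUVNodes ∕ node N18 = NE5 — closure-ledger item (iii): THE LETTER FORM OF (T3) FOR THE TRANSPORT OF RECORD — the orbit statement `hsat` for
# `TΦOfRecord Φ` from the six letters of the comb-gauge step, and BOTH TRANSPORT CLAUSES OF N18's READING FROM NUMERICS + PER-DOMAIN LETTER DATA
# (Track A, DAG node N18 = `T4OutputRate.NE5` :211; cluster K4 «SpineRates», item K3⁷ `SpineGivenEndpointR13SepCoPH`; seat pub-ymgap-dag-n18-w3 g3)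

HONEST FRAMING.  Count-neutral kernel bookkeeping (`--supports stmt-QuantumFields-20544 --as helper`): composition BY NAME of this seat's FILES 1–6
(`…N18TransportOfRecordCovariance`, `…N18CombStep{FirstOrderBond,FirstOrderFrame,OrbitFrame}`, `…N18BackgroundPlaqOfRecordSpace`, `…N18TorusDomainCover`).
The LETTERS — per table point `(j, Y, Φ)`: a `G`-valued factor `U` of `Ū = TΦOfRecord(Φ).U` with (1.11)–(1.12) at run A's radius, a traceless potential `A′`
with `|A′| ≤ a`, `|∇^ξ_U A′| ≤ a₁`, the plaquette letter of `Ū`, the `Gᶜ`-membership of `Ū`, a traceless comb generator `l` with `|l| ≤ ξδ₀`, `|∇^ξ_U l| ≤ ξδ₁`,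
and the CANCELLED sums `|A′ − i∇^ξ_U l| < s₀`, `|∇^ξ_U(A′ − i∇^ξ_U l)| < s₁`, fitting run A's radii — are [Balaban1985Averaging] Props. 1–3 ∕ [Balaban1987RG1]
(1.11)–(1.14) content for the (0.4) average of record and are NOT produced here (item 3 proper of `N18-BETA-SPEC.md`; the landed bricks are this seat's g2
`…N18AvgPotential*`∕`…N18LocalGauge*` files, dag-n18-d's modules 19a∕22–27, UST `Prop8Chart*`).  NE5 NOT PRINTED ∕ NOT proved; N18 NOT discharged; nothing
about the continuum ∕ OS ∕ mass gap ∕ Clay.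

WHAT.
* §1 ★ `exists_orbit_TΦOfRecord_of_letters` — FILE 4's ★★ `exists_orbit_comb_firstOrder_frameI` AT THE TRANSPORTED PAIR `TΦOfRecord F N k Φ` (any model over
  `M_N(ℂ)` with the standing provisos): the `𝐉`-inputs DISCHARGED (`J = 0`: FILE 1 `TΦOfRecord_J_mem_gc`, `condIII_TΦOfRecord_of_plaq`), so that (iii) costs only
  the plaquette letter of `Ū` and `0 < γ₀`; ★ `exists_orbit_TΦOfRecord_of_letters_su` — at `suModel N` with the provisos discharged and the algebra clauses as TRACES.
* §2 ★★★★ `admTransport_spaceOfRecord_unit_ofRecord_orbit_of_letters` — FILE 6's `…_of_top` with `hsat` REPLACED by per-`(j, Y, Φ)` letter data (an explicit `∃`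
  over the factor, the potential, the comb generator and eight radii∕letters with their side conditions): N18's two transport clauses at the table of record from
  `hGc`, the provisos of run A's model, `0 < M`, the top-radius numerics of run B, `hα`, and THE LETTERS.

0 `def`, 0 `sorry`.  References: T. Bałaban, CMP **109** (1987) 249–301 [Balaban1987RG1] ((0.21)–(0.25) pp.256–257, (1.10)–(1.16) p.262); CMP **98** (1985)
17–51 [Balaban1985Averaging] (Props. 1–3 pp.26–36, (62)–(63) p.29).
-/

noncomputable section

open Set
open scoped Matrix.Norms.L2Operator

namespace YMDAG.N18.TransportOfRecord

open Complex (I)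
open Literature.MathematicalPhysics.QuantumFieldTheory.Balaban1983to89
open Literature.MathematicalPhysics.QuantumFieldTheory.Balaban1983to89.T4Continuum
open Literature.MathematicalPhysics.QuantumFieldTheory.Balaban1983to89.B12RegularSpaces111
open Literature.MathematicalPhysics.QuantumFieldTheory.Balaban1983to89.B12RegularSpaces111SpecialUnitary
open Literature.MathematicalPhysics.QuantumFieldTheory.Balaban1983to89.B12Membership313II (newPot)
open Literature.MathematicalPhysics.QuantumFieldTheory.Balaban1983to89.Node00 (MatA ιSU plaqInside)
open Literature.MathematicalPhysics.QuantumFieldTheory.Balaban1983to89.Node00.Sect2 (domSys domSites domCount CPair ofBackgroundC embedPair spaceI frameI Setting Residual)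
open Literature.MathematicalPhysics.QuantumFieldTheory.Balaban1983to89.Node00.W1
open Literature.MathematicalPhysics.QuantumFieldTheory.Balaban1983to89.ExpMeanLog (deltaSU)
open Summit.QuantumFields.BalabanUV.T4Continuum.B13Carriers (transportRaw)
open YMDAG.N18.CombStep (exists_orbit_comb_firstOrder_frameI)

/-! ## §1 The orbit statement for the transported pair from the letters -/

section Letters

variable {F : T4Family} {N k : ℕ}

/-- ★ **(T3) IN ORBIT FORM FOR THE TRANSPORTED PAIR `Ψ = TΦOfRecord F N k Φ`, FROM THE LETTERS** (any model `𝓜` over `M_N(ℂ)` with the standing provisos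
`‖·‖ ≤ 1` on `G`, `G ≤ Gᶜ`, `Ad(G)𝔤ᶜ ⊆ 𝔤ᶜ`, `𝔤ᶜ` closed under small BCH steps): given a factorisation `Ū = (exp iξA′)·U` of `Ū = Ψ.U` with (i) for `U` at `α₀`,
`A′` `𝔤ᶜ`-valued with `|A′| ≤ a`, `|∇^ξ_U A′| ≤ a₁` on the frame, `Ū` `Gᶜ`-valued on the frame bonds, the plaquette letter `|∂Ū − 1| < α₀ξ²` inside `Y`, a comb
generator `l` (`𝔤ᶜ`-valued on `Y`, `exp(−l) ∈ Gᶜ` everywhere, `Ad(exp(−l))𝔤ᶜ ⊆ 𝔤ᶜ` on `Y`, `|l| ≤ ξδ₀` on `Y`, `|∇^ξ_U l| ≤ ξδ₁` on the stencils of `Y`) and the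
cancelled sums `< s₀`, `< s₁`, with the side conditions of FILE 4, there is a `Gᶜ`-valued `w` (`= exp(−l)`) with `SatisfiesI_III 𝓜 (frameI Rz M j Y) c α₀′ α₁′ γ₀′
(act w Ψ)`.  The `𝐉`-slot of `Ψ` is `0` (W1-18), so (1.14)'s `𝐉`-clause and the `𝔤ᶜ`-clause cost nothing (FILE 1 §2). [cite: Balaban1987RG1, (1.10)-(1.16) p.262; Balaban1985Averaging, (62)-(63) p.29] -/
theorem exists_orbit_TΦOfRecord_of_letters {𝓜 : Model (MatA N)} (hG1 : ∀ g ∈ 𝓜.G, ‖(g : MatA N)‖ ≤ 1) (hGc : 𝓜.G ≤ 𝓜.Gc)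
    (hgc : ∀ g ∈ 𝓜.G, ∀ X ∈ 𝓜.gc, (g : MatA N) * X * ↑g⁻¹ ∈ 𝓜.gc)
    {c : StepConsts} (hgcN : ∀ X ∈ 𝓜.gc, ∀ Y ∈ 𝓜.gc, c.ξ * (‖X‖ + ‖Y‖) ≤ 1 / 4 → newPot c.ξ X Y ∈ 𝓜.gc)
    (Rz : Residual (F.P k) (MatA N)) (M j : ℕ) (Y : Set (Site (F.P k) 0)) (hξ : 0 < c.ξ) (hcB : 0 ≤ c.cB)
    {α₀ γ₀ a a₁ δ₀ δ₁ s₀ s₁ α₀' α₁' γ₀' : ℝ} (hα₀ : 0 ≤ α₀) (hγ₀ : 0 < γ₀) (ha : 0 ≤ a) (hδ₀ : 0 ≤ δ₀)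
    (hs : c.ξ * (a + 2 * δ₀) ≤ 1 / 16)
    (hα₀' : Real.exp (2 * (c.ξ * δ₀)) * α₀ ≤ α₀') (hγ₀' : Real.exp (2 * (c.ξ * δ₀)) * γ₀ ≤ γ₀')
    (hα₁'0 : s₀ + 4 * c.ξ * δ₀ * (a + δ₀) ≤ α₁')
    (hα₁'1 : s₁ + (4 * c.ξ * (δ₀ * a₁ + a * (2 * c.ξ * α₀ * δ₀ + δ₁)) +
        4 * c.ξ * ((a + (9 / 8) * δ₀) * δ₁ +
          δ₀ * ((1 + 4 * (c.ξ * δ₀)) * a₁ + (1 + 4 * (c.ξ * a)) * (2 * c.ξ * α₀ * δ₀ + δ₁)))) ≤ α₁')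
    (Φ : FieldPair (F.P (k + 1)) 0 (MatA N)ˣ (MatA N))
    (hUGc : ∀ b ∈ (frameI Rz M j Y).X.bonds, (TΦOfRecord F N k Φ).U b ∈ 𝓜.Gc)
    {U : PBond (F.P k) 0 → (MatA N)ˣ} {A' : PBond (F.P k) 0 → MatA N} (hf : Factors c (TΦOfRecord F N k Φ).U U A')
    (hI : CondI 𝓜 (frameI Rz M j Y) c α₀ U)
    (hAgc : ∀ b ∈ (frameI Rz M j Y).X.bonds, A' b ∈ 𝓜.gc) (hA : ∀ b ∈ (frameI Rz M j Y).X.bonds, ‖A' b‖ ≤ a)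
    (hA1 : ∀ q ∈ (frameI Rz M j Y).X.dpairs, ‖nabla c.ξ U q.2.1 (fun y => A' ⟨y, q.2.2⟩) q.1‖ ≤ a₁)
    (hplaq : ∀ p ∈ (frameI Rz M j Y).X.plaqs, ‖(↑(plaq (TΦOfRecord F N k Φ).U p) : MatA N) - 1‖ < α₀ * c.ξ ^ 2)
    {l : Site (F.P k) 0 → MatA N} (hlgc : ∀ x ∈ Y, l x ∈ 𝓜.gc)
    (hlGc : ∀ x, Beta.BackgroundVertices.expUnit ℂ (-l x) ∈ 𝓜.Gc)
    (hgcl : ∀ x ∈ Y, ∀ X ∈ 𝓜.gc,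
      (Beta.BackgroundVertices.expUnit ℂ (-l x) : MatA N) * X * ↑(Beta.BackgroundVertices.expUnit ℂ (-l x))⁻¹ ∈ 𝓜.gc)
    (hl0 : ∀ x ∈ Y, ‖l x‖ ≤ c.ξ * δ₀)
    (hl1 : ∀ (x : Site (F.P k) 0) (μ : Fin (F.P k).d), x ∈ Y → x.shift μ ∈ Y → ‖nabla c.ξ U μ l x‖ ≤ c.ξ * δ₁)
    (hS0 : ∀ b ∈ (frameI Rz M j Y).X.bonds, ‖A' b - I • nabla c.ξ U b.dir l b.src‖ < s₀)
    (hS1 : ∀ q ∈ (frameI Rz M j Y).X.dpairs,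
      ‖nabla c.ξ U q.2.1 (fun y => A' ⟨y, q.2.2⟩ - I • nabla c.ξ U q.2.2 l y) q.1‖ < s₁) :
    ∃ w : Site (F.P k) 0 → (MatA N)ˣ, (∀ x, w x ∈ 𝓜.Gc) ∧ SatisfiesI_III 𝓜 (frameI Rz M j Y) c α₀' α₁' γ₀' (act w (TΦOfRecord F N k Φ)) :=
  exists_orbit_comb_firstOrder_frameI hG1 hGc hgc hgcN Rz M j Y hξ hcB hα₀ ha hδ₀ hs hα₀' hγ₀' hα₁'0 hα₁'1 hUGc
    (TΦOfRecord_J_mem_gc 𝓜 Φ _) hf hI hAgc hA hA1 (condIII_TΦOfRecord_of_plaq Φ _ c hγ₀ hplaq) hlgc hlGc hgcl hl0 hl1 hS0 hS1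

/-- ★ **THE SAME AT THE MODEL OF RECORD `suModel N`** (`G = SU(N)`, `Gᶜ = SL(N, ℂ)`, `𝔤ᶜ = 𝔰𝔩(N, ℂ)`; the settings of record `Node00.settingOfRecord₁₁∕₁₂∕₁₃` have
`𝓜 := suModel N` by `rfl`): provisos discharged by `B12RegularSpaces111SpecialUnitary`, the algebra clauses as traces (`A′` traceless on the frame bonds, `l`
traceless), via FILE 4's ★★★. [cite: Balaban1987RG1, (1.10)-(1.16) p.262; Balaban1985Averaging, (62)-(63) p.29] -/
theorem exists_orbit_TΦOfRecord_of_letters_su (Rz : Residual (F.P k) (MatA N)) (M j : ℕ) (Y : Set (Site (F.P k) 0))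
    {c : StepConsts} (hξ : 0 < c.ξ) (hcB : 0 ≤ c.cB)
    {α₀ γ₀ a a₁ δ₀ δ₁ s₀ s₁ α₀' α₁' γ₀' : ℝ} (hα₀ : 0 ≤ α₀) (hγ₀ : 0 < γ₀) (ha : 0 ≤ a) (hδ₀ : 0 ≤ δ₀)
    (hs : c.ξ * (a + 2 * δ₀) ≤ 1 / 16)
    (hα₀' : Real.exp (2 * (c.ξ * δ₀)) * α₀ ≤ α₀') (hγ₀' : Real.exp (2 * (c.ξ * δ₀)) * γ₀ ≤ γ₀')
    (hα₁'0 : s₀ + 4 * c.ξ * δ₀ * (a + δ₀) ≤ α₁')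
    (hα₁'1 : s₁ + (4 * c.ξ * (δ₀ * a₁ + a * (2 * c.ξ * α₀ * δ₀ + δ₁)) +
        4 * c.ξ * ((a + (9 / 8) * δ₀) * δ₁ +
          δ₀ * ((1 + 4 * (c.ξ * δ₀)) * a₁ + (1 + 4 * (c.ξ * a)) * (2 * c.ξ * α₀ * δ₀ + δ₁)))) ≤ α₁')
    (Φ : FieldPair (F.P (k + 1)) 0 (MatA N)ˣ (MatA N))
    (hUGc : ∀ b ∈ (frameI Rz M j Y).X.bonds, (TΦOfRecord F N k Φ).U b ∈ (suModel N).Gc)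
    {U : PBond (F.P k) 0 → (MatA N)ˣ} {A' : PBond (F.P k) 0 → MatA N} (hf : Factors c (TΦOfRecord F N k Φ).U U A')
    (hI : CondI (suModel N) (frameI Rz M j Y) c α₀ U)
    (hAtr : ∀ b ∈ (frameI Rz M j Y).X.bonds, (A' b).trace = 0) (hA : ∀ b ∈ (frameI Rz M j Y).X.bonds, ‖A' b‖ ≤ a)
    (hA1 : ∀ q ∈ (frameI Rz M j Y).X.dpairs, ‖nabla c.ξ U q.2.1 (fun y => A' ⟨y, q.2.2⟩) q.1‖ ≤ a₁)
    (hplaq : ∀ p ∈ (frameI Rz M j Y).X.plaqs, ‖(↑(plaq (TΦOfRecord F N k Φ).U p) : MatA N) - 1‖ < α₀ * c.ξ ^ 2)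
    {l : Site (F.P k) 0 → MatA N} (hl : ∀ x, (l x).trace = 0) (hl0 : ∀ x ∈ Y, ‖l x‖ ≤ c.ξ * δ₀)
    (hl1 : ∀ (x : Site (F.P k) 0) (μ : Fin (F.P k).d), x ∈ Y → x.shift μ ∈ Y → ‖nabla c.ξ U μ l x‖ ≤ c.ξ * δ₁)
    (hS0 : ∀ b ∈ (frameI Rz M j Y).X.bonds, ‖A' b - I • nabla c.ξ U b.dir l b.src‖ < s₀)
    (hS1 : ∀ q ∈ (frameI Rz M j Y).X.dpairs,
      ‖nabla c.ξ U q.2.1 (fun y => A' ⟨y, q.2.2⟩ - I • nabla c.ξ U q.2.2 l y) q.1‖ < s₁) :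
    ∃ w : Site (F.P k) 0 → (MatA N)ˣ, (∀ x, w x ∈ (suModel N).Gc) ∧
      SatisfiesI_III (suModel N) (frameI Rz M j Y) c α₀' α₁' γ₀' (act w (TΦOfRecord F N k Φ)) :=
  YMDAG.N18.CombStep.exists_orbit_comb_firstOrder_frameI_su Rz M j Y hξ hcB hα₀ ha hδ₀ hs hα₀' hγ₀' hα₁'0 hα₁'1 hUGc
    (TΦOfRecord_J_mem_gc (suModel N) Φ _) hf hI hAtr hA hA1 (condIII_TΦOfRecord_of_plaq Φ _ c hγ₀ hplaq) hl hl0 hl1 hS0 hS1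

end Letters

/-! ## §2 Both transport clauses of N18's reading from numerics and per-domain letter data -/

section Record

variable (F : T4Family) (N M k : ℕ) [NeZero N]

/-- ★★★★ **BOTH TRANSPORT CLAUSES OF N18's READING AT THE TABLE OF RECORD FROM NUMERICS AND THE LETTERS** — FILE 6's
`admTransport_spaceOfRecord_unit_ofRecord_orbit_of_top` with the analysis input `hsat` REPLACED by PER-`(j, Y, Φ)` LETTER DATA `hletters`: for every table point of
run B — a pair `Φ` satisfying (i)–(iii) of run B at level `j+1` on `π(j, Y)` — the letters of §1 for the transported pair `TΦOfRecord F N k Φ` on run A's frame at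
level `j` on `Y`, fitting run A's radii `(α₀ k j, α₁ k j, α₀ k j)`.  Displayed besides: `hGc` (run B's `Gᶜ` inside run A's), the standing provisos of run A's model
(`rfl`-discharged by `suModel_*` at the settings of record), `0 ≤ cB`, `0 < M`, the top-radius numerics of run B, `hα`.  THIS is the remaining analysis
obligation of N18's closure-ledger item (iii), stated in one place: PRODUCE THE LETTERS. [cite: Balaban1987RG1, (0.21)-(0.25) pp.256-257, (1.10)-(1.16) p.262; Balaban1985Averaging, Props. 1-3 pp.26-36, (62)-(63) p.29] -/
theorem admTransport_spaceOfRecord_unit_ofRecord_orbit_of_letters (Sg : ℕ → Setting (MatA N) (Node00.SU N)) (α₀ α₁ : ℕ → ℕ → ℝ)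
    (hGc : (Sg (k + 1)).𝓜.Gc ≤ (Sg k).𝓜.Gc)
    (hG1 : ∀ g ∈ (Sg k).𝓜.G, ‖(g : MatA N)‖ ≤ 1) (hGGc : (Sg k).𝓜.G ≤ (Sg k).𝓜.Gc)
    (hgc : ∀ g ∈ (Sg k).𝓜.G, ∀ X ∈ (Sg k).𝓜.gc, (g : MatA N) * X * ↑g⁻¹ ∈ (Sg k).𝓜.gc)
    (hgcN : ∀ (j : ℕ), ∀ X ∈ (Sg k).𝓜.gc, ∀ Y ∈ (Sg k).𝓜.gc,
      (StepConsts.ofParams (F.P k) (Sg k).cB j).ξ * (‖X‖ + ‖Y‖) ≤ 1 / 4 → newPot (StepConsts.ofParams (F.P k) (Sg k).cB j).ξ X Y ∈ (Sg k).𝓜.gc)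
    (hcB : 0 ≤ (Sg k).cB) (hM : 0 < M) (ha : 0 ≤ α₀ (k + 1) 0)
    (haδ : (((((F.P (k + 1)).d + 2) * (F.P (k + 1)).L : ℕ) : ℝ) ^ 2 / 4) * α₀ (k + 1) 0 < deltaSU (Fin N))
    (hα : ∀ j, 0 < α₀ k j)
    (hletters : ∀ (j : ℕ) (Y : (domSys (F.P k) M j).Dom) (Φ : FieldPair (F.P (k + 1)) 0 (MatA N)ˣ (MatA N)),
      SatisfiesI_III (Sg (k + 1)).𝓜 (frameI (Residual.unit (F.P (k + 1)) (MatA N)) M (j + 1) (domSites (F.P (k + 1)) M (j + 1) (pairOfRecord F M k ⟨j, Y⟩).2))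
          (StepConsts.ofParams (F.P (k + 1)) (Sg (k + 1)).cB (j + 1)) (α₀ (k + 1) (j + 1)) (α₁ (k + 1) (j + 1)) (α₀ (k + 1) (j + 1)) Φ →
        ∃ (U : PBond (F.P k) 0 → (MatA N)ˣ) (A' : PBond (F.P k) 0 → MatA N) (l : Site (F.P k) 0 → MatA N)
          (α₀B γ₀B a a₁ δ₀ δ₁ s₀ s₁ : ℝ),
          0 ≤ α₀B ∧ 0 < γ₀B ∧ 0 ≤ a ∧ 0 ≤ δ₀ ∧
          (StepConsts.ofParams (F.P k) (Sg k).cB j).ξ * (a + 2 * δ₀) ≤ 1 / 16 ∧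
          Real.exp (2 * ((StepConsts.ofParams (F.P k) (Sg k).cB j).ξ * δ₀)) * α₀B ≤ α₀ k j ∧
          Real.exp (2 * ((StepConsts.ofParams (F.P k) (Sg k).cB j).ξ * δ₀)) * γ₀B ≤ α₀ k j ∧
          s₀ + 4 * (StepConsts.ofParams (F.P k) (Sg k).cB j).ξ * δ₀ * (a + δ₀) ≤ α₁ k j ∧
          s₁ + (4 * (StepConsts.ofParams (F.P k) (Sg k).cB j).ξ * (δ₀ * a₁ + a * (2 * (StepConsts.ofParams (F.P k) (Sg k).cB j).ξ * α₀B * δ₀ + δ₁)) +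
              4 * (StepConsts.ofParams (F.P k) (Sg k).cB j).ξ * ((a + (9 / 8) * δ₀) * δ₁ +
                δ₀ * ((1 + 4 * ((StepConsts.ofParams (F.P k) (Sg k).cB j).ξ * δ₀)) * a₁ +
                  (1 + 4 * ((StepConsts.ofParams (F.P k) (Sg k).cB j).ξ * a)) * (2 * (StepConsts.ofParams (F.P k) (Sg k).cB j).ξ * α₀B * δ₀ + δ₁)))) ≤
            α₁ k j ∧
          (∀ b ∈ (frameI (Residual.unit (F.P k) (MatA N)) M j (domSites (F.P k) M j Y)).X.bonds, (TΦOfRecord F N k Φ).U b ∈ (Sg k).𝓜.Gc) ∧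
          Factors (StepConsts.ofParams (F.P k) (Sg k).cB j) (TΦOfRecord F N k Φ).U U A' ∧
          CondI (Sg k).𝓜 (frameI (Residual.unit (F.P k) (MatA N)) M j (domSites (F.P k) M j Y)) (StepConsts.ofParams (F.P k) (Sg k).cB j) α₀B U ∧
          (∀ b ∈ (frameI (Residual.unit (F.P k) (MatA N)) M j (domSites (F.P k) M j Y)).X.bonds, A' b ∈ (Sg k).𝓜.gc) ∧
          (∀ b ∈ (frameI (Residual.unit (F.P k) (MatA N)) M j (domSites (F.P k) M j Y)).X.bonds, ‖A' b‖ ≤ a) ∧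
          (∀ q ∈ (frameI (Residual.unit (F.P k) (MatA N)) M j (domSites (F.P k) M j Y)).X.dpairs,
            ‖nabla (StepConsts.ofParams (F.P k) (Sg k).cB j).ξ U q.2.1 (fun y => A' ⟨y, q.2.2⟩) q.1‖ ≤ a₁) ∧
          (∀ p ∈ (frameI (Residual.unit (F.P k) (MatA N)) M j (domSites (F.P k) M j Y)).X.plaqs,
            ‖(↑(plaq (TΦOfRecord F N k Φ).U p) : MatA N) - 1‖ < α₀B * (StepConsts.ofParams (F.P k) (Sg k).cB j).ξ ^ 2) ∧
          (∀ x ∈ domSites (F.P k) M j Y, l x ∈ (Sg k).𝓜.gc) ∧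
          (∀ x, Beta.BackgroundVertices.expUnit ℂ (-l x) ∈ (Sg k).𝓜.Gc) ∧
          (∀ x ∈ domSites (F.P k) M j Y, ∀ X ∈ (Sg k).𝓜.gc,
            (Beta.BackgroundVertices.expUnit ℂ (-l x) : MatA N) * X * ↑(Beta.BackgroundVertices.expUnit ℂ (-l x))⁻¹ ∈ (Sg k).𝓜.gc) ∧
          (∀ x ∈ domSites (F.P k) M j Y, ‖l x‖ ≤ (StepConsts.ofParams (F.P k) (Sg k).cB j).ξ * δ₀) ∧
          (∀ (x : Site (F.P k) 0) (μ : Fin (F.P k).d), x ∈ domSites (F.P k) M j Y → x.shift μ ∈ domSites (F.P k) M j Y →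
            ‖nabla (StepConsts.ofParams (F.P k) (Sg k).cB j).ξ U μ l x‖ ≤ (StepConsts.ofParams (F.P k) (Sg k).cB j).ξ * δ₁) ∧
          (∀ b ∈ (frameI (Residual.unit (F.P k) (MatA N)) M j (domSites (F.P k) M j Y)).X.bonds,
            ‖A' b - I • nabla (StepConsts.ofParams (F.P k) (Sg k).cB j).ξ U b.dir l b.src‖ < s₀) ∧
          (∀ q ∈ (frameI (Residual.unit (F.P k) (MatA N)) M j (domSites (F.P k) M j Y)).X.dpairs,
            ‖nabla (StepConsts.ofParams (F.P k) (Sg k).cB j).ξ U q.2.1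
              (fun y => A' ⟨y, q.2.2⟩ - I • nabla (StepConsts.ofParams (F.P k) (Sg k).cB j).ξ U q.2.2 l y) q.1‖ < s₁)) :
    (∀ (X : Node00.W1.Dom (F.P k) M) (ψ : CPair (F.P (k + 1)) (MatA N)),
        ψ ∈ spaceOfRecord (M := M) (Sg (k + 1)) (Residual.unit (F.P (k + 1)) (MatA N)) (α₀ (k + 1)) (α₁ (k + 1)) (pairOfRecord F M k X).1
            (pairOfRecord F M k X).2 →
          TcfgOfRecord F N k ψ ∈ spaceOfRecord (M := M) (Sg k) (Residual.unit (F.P k) (MatA N)) (α₀ k) (α₁ k) X.1 X.2) ∧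
      ∀ U : GaugeField (F.P (k + 1)) 0 (Node00.SU N),
        (∀ (j : ℕ) (Y : (domSys (F.P (k + 1)) M j).Dom),
            ofBackgroundC (ιSU N) U ∈ spaceOfRecord (M := M) (Sg (k + 1)) (Residual.unit (F.P (k + 1)) (MatA N)) (α₀ (k + 1)) (α₁ (k + 1)) j Y) →
          ∀ (j : ℕ) (Y : (domSys (F.P k) M j).Dom),
            ofBackgroundC (ιSU N) (transportRaw F k (Node00.avOfRecord F N (k + 1) 0) U) ∈
              spaceOfRecord (M := M) (Sg k) (Residual.unit (F.P k) (MatA N)) (α₀ k) (α₁ k) j Y := by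
  refine admTransport_spaceOfRecord_unit_ofRecord_orbit_of_top F N M k Sg α₀ α₁ hGc hM ha haδ hα fun j Y Φ hΦ => ?_
  obtain ⟨U, A', l, α₀B, γ₀B, a, a₁, δ₀, δ₁, s₀, s₁, hα₀B, hγ₀B, ha', hδ₀, hs, hα₀', hγ₀', hα₁'0, hα₁'1, hUGc, hf, hI, hAgc, hA, hA1,
    hplaq, hlgc, hlGc, hgcl, hl0, hl1, hS0, hS1⟩ := hletters j Y Φ hΦ
  have hξ : 0 < (StepConsts.ofParams (F.P k) (Sg k).cB j).ξ := by
    show 0 < (F.P k).eta j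
    exact pow_pos (inv_pos.mpr (Nat.cast_pos.mpr (F.P k).L_pos)) j
  exact exists_orbit_TΦOfRecord_of_letters hG1 hGGc hgc (hgcN j) _ M j _ hξ hcB hα₀B hγ₀B ha' hδ₀ hs hα₀' hγ₀' hα₁'0 hα₁'1 Φ hUGc hf hI
    hAgc hA hA1 hplaq hlgc hlGc hgcl hl0 hl1 hS0 hS1

end Record

end YMDAG.N18.TransportOfRecord

end
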